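import Summits.AtomisticToContinuum.Crystallization.Theorems.FreeSplittingCertificatesStrictSplittingRuleFarPencilCutoff

/-!
# `StrictSplittingRule` (stmt-AtomisticToContinuum-12560): the continuum far pencil with a SMEARED FREE BOUNDARY — exact interface flux

Route `FreeSplittingCertificates`, crux r3 `StrictSplittingRule` (H12⋆ = `stub_coreJointCoercive`), unit b2b-freesplit-B gen 10.
VALUE = a tree THEOREM: the free-boundary form of the continuum far lemma (HOME CERT.md §16 (6): far form on an exterior domain plus an
interface flux through the sphere `|x| = R_*`) with the sphere flux replaced by its smeared version over a cut-off layer — no surface integrals,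
no sector analysis, and NO Young-inequality waste (compare `…FarPencilCutoff`, whose interface cost pays receipts on the artificial gradient `∇χ ⊗ v`).
NOT a proof of H12⋆, NOT summit progress.

For `v ∈ C²` with compact support (no condition at the reference site `0`) and a `C²` weight `χ` with `0 ∉ tsupport χ`:
* `integral_sq_mul_fpDivFlux`: **`∫ χ²·div Φ = −∫ 2χ·⟪∇χ, Φ⟫`** (Mathlib's integration by parts for line derivatives with `g = χ²`; `Φ = fpFlux v` is
  singular like `|x|⁻⁷` at `0` but every integrand carries a factor `χ` or `χ²` vanishing near `0`);
* `farPencil_weighted_integral_le`: **`∫ χ²·Num ≤ (17/200)·∫ χ²·Den + (1/18)·∫ 2χ·⟪∇χ, Φ⟫`** — the pointwise certificate of `…FarPencilPointwise`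
  multiplied by `χ² ≥ 0` and integrated.  With `χ` rising from `0` to `1` across a layer `R ≤ |x| ≤ λR` the last term is the free-boundary flux of
  CERT §16 (6)/§17 averaged over the layer: `⟪∇χ,Φ⟫ = χ′(r)·Φ·x̂`, `Φ·x̂ = |x|⁻⁷|v|² + 7|x|⁻⁹⟪x,v⟫² + |x|⁻⁶ x̂·((v·∇)v − (div v)v)` — to be paid by the
  NEAR side, which keeps every term in the layer (the `θ = 0` split of CERT §16 (7)).
HONEST FRAMING: continuum statement about test fields and a weight; the lattice→continuum transfer and the near certificate are untouched;
NOT a proof of H12⋆, NOT summit progress.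
-/

noncomputable section

open MeasureTheory Topology Filter

namespace Summit.AtomisticToContinuum.Crystallization.Theorems.StrictSplittingRuleBirth

variable {v : (Fin 3 → ℝ) → (Fin 3 → ℝ)} {χ : (Fin 3 → ℝ) → ℝ}

/-- `⟪∇χ(x), Φ(x)⟫ = Σⱼ ∂ⱼχ · Φⱼ`. -/
def fpFluxDotGrad (v : (Fin 3 → ℝ) → (Fin 3 → ℝ)) (χ : (Fin 3 → ℝ) → ℝ) (x : Fin 3 → ℝ) : ℝ :=
  fpGradS χ x 0 * fpFlux v x 0 + fpGradS χ x 1 * fpFlux v x 1 + fpGradS χ x 2 * fpFlux v x 2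

/-- The weight `χ²` has line derivative `2χ·∂ₖχ` along `eₖ`, everywhere. -/
theorem hasLineDerivAt_sq (hχ : ContDiff ℝ 2 χ) (x : Fin 3 → ℝ) (k : Fin 3) :
    HasLineDerivAt ℝ (fun y => χ y ^ 2) (2 * χ x * fpGradS χ x k) x (fpE k) := by
  have hd : DifferentiableAt ℝ χ x := hχ.differentiable (by simp) x
  have h1 : HasDerivAt (χ ∘ fun t : ℝ => x + t • fpE k) (fderiv ℝ χ x (fpE k)) 0 :=
    hd.hasFDerivAt.comp_hasDerivAt_of_eq (0 : ℝ) (hasDerivAt_fpLine x (fpE k)) (by simp)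
  have h2 := h1.pow 2
  show HasDerivAt (fun t : ℝ => χ (x + t • fpE k) ^ 2) (2 * χ x * fpGradS χ x k) 0
  refine (h2.congr_deriv ?_).congr_of_eventuallyEq (Filter.Eventually.of_forall fun t => rfl)
  simp only [Function.comp, zero_smul, add_zero, fpGradS]
  norm_num

section integrability
variable (hv : ContDiff ℝ 2 v) (hc : HasCompactSupport v) (hχ : ContDiff ℝ 2 χ) (hχ0 : (0 : Fin 3 → ℝ) ∉ tsupport χ)
include hv hc hχ hχ0

/-- `χ²·∂ⱼΦⱼ` is integrable. -/
theorem integrable_sq_mul_fpFluxDeriv (j : Fin 3) : Integrable fun y => fpFluxDeriv v y j j * χ y ^ 2 := by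
  have hχc : Continuous χ := hχ.continuous
  refine fp_integrable₀ hc (fun y hy => ?_) ?_ (fun y hy => ?_)
  · exact (continuousAt_fpFluxDeriv hv hy j j).mul ((hχc.pow 2).continuousAt)
  · filter_upwards [fpGradS_eventually_zero hχ0] with y hy
    simp [hy.1]
  · simp [fpFluxDeriv_eq_zero_of_notMem hy]

/-- `Φⱼ·(2χ∂ⱼχ)` is integrable. -/
theorem integrable_fpFlux_mul_grad_sq (j : Fin 3) : Integrable fun y => fpFlux v y j * (2 * χ y * fpGradS χ y j) := by
  have hχc : Continuous χ := hχ.continuous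
  have hχ' : Continuous fun y => fpGradS χ y j :=
    (continuous_apply j).comp (continuous_pi fun i => (hχ.continuous_fderiv (by simp)).clm_apply continuous_const)
  refine fp_integrable₀ hc (fun y hy => ?_) ?_ (fun y hy => ?_)
  · exact (continuousAt_fpFlux hv hy j).mul (((hχc.const_mul 2).mul hχ').continuousAt)
  · filter_upwards [fpGradS_eventually_zero hχ0] with y hy
    simp [hy.1]
  · simp [fpFlux_eq_zero_of_notMem hy]

/-- `Φⱼ·χ²` is integrable. -/
theorem integrable_fpFlux_mul_sq (j : Fin 3) : Integrable fun y => fpFlux v y j * χ y ^ 2 := by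
  have hχc : Continuous χ := hχ.continuous
  refine fp_integrable₀ hc (fun y hy => ?_) ?_ (fun y hy => ?_)
  · exact (continuousAt_fpFlux hv hy j).mul ((hχc.pow 2).continuousAt)
  · filter_upwards [fpGradS_eventually_zero hχ0] with y hy
    simp [hy.1]
  · simp [fpFlux_eq_zero_of_notMem hy]

/-- `χ²·Num` along the field is integrable. -/
theorem integrable_sq_mul_fpNum : Integrable fun y => χ y ^ 2 * fpNum y (v y) (fpGrad v y) := by
  have hχc : Continuous χ := hχ.continuous
  refine fp_integrable₀ hc (fun y hy => ?_) ?_ (fun y hy => ?_)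
  · exact ((hχc.pow 2).continuousAt).mul (continuousAt_fpNum hv hy)
  · filter_upwards [fpGradS_eventually_zero hχ0] with y hy
    simp [hy.1]
  · have h1 : v y = 0 := image_eq_zero_of_notMem_tsupport hy
    have h2 : fderiv ℝ v y = 0 := image_eq_zero_of_notMem_tsupport fun h => hy (tsupport_fderiv_subset ℝ h)
    simp [fpNum, fpGrad, fpFrob, fpDot, h1, h2]

/-- `χ²·fpDivFlux` along the field is integrable. -/
theorem integrable_sq_mul_fpDivFlux : Integrable fun y => χ y ^ 2 * fpDivFlux y (v y) (fpGrad v y) := by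
  have hχc : Continuous χ := hχ.continuous
  have hvc : Continuous v := hv.continuous
  have hGc : Continuous (fpGrad v) := continuous_fpGrad hv
  refine fp_integrable₀ hc (fun y hy => ?_) ?_ (fun y hy => ?_)
  · have hu := continuousAt_fpSq_inv hy
    have hA : Continuous fun z : Fin 3 → ℝ => fpTrSq (fpGrad v z) - fpTr (fpGrad v z) ^ 2 := by unfold fpTrSq fpTr; fun_prop
    have hB : Continuous fun z : Fin 3 → ℝ => 2 * (v z 0 ^ 2 + v z 1 ^ 2 + v z 2 ^ 2) + 2 * fpXGV z (v z) (fpGrad v z) +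
        fpVGX z (v z) (fpGrad v z) + 13 * (fpDot z (v z) * fpTr (fpGrad v z)) := by
      unfold fpXGV fpVGX fpDot fpTr; fun_prop
    have hC : Continuous fun z : Fin 3 → ℝ => fpDot z (v z) ^ 2 := by unfold fpDot; fun_prop
    refine ((hχc.pow 2).continuousAt).mul ?_
    unfold fpDivFlux
    exact (((hu.pow 3).mul hA.continuousAt).add ((hu.pow 4).mul hB.continuousAt)).sub
      (((hu.pow 5).const_mul 56).mul hC.continuousAt)
  · filter_upwards [fpGradS_eventually_zero hχ0] with y hy
    simp [hy.1]
  · simp [fpDivFlux_eq_zero_of_notMem hy]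

end integrability

/-- **`∫ χ²·∂ⱼΦⱼ = −∫ Φⱼ·∂ⱼ(χ²)`** — integration by parts for line derivatives with the weight `g = χ²`. -/
theorem integral_sq_mul_fpFluxDeriv (hv : ContDiff ℝ 2 v) (hc : HasCompactSupport v) (hχ : ContDiff ℝ 2 χ)
    (hχ0 : (0 : Fin 3 → ℝ) ∉ tsupport χ) (j : Fin 3) :
    ∫ y, fpFlux v y j * (2 * χ y * fpGradS χ y j) = - ∫ y, fpFluxDeriv v y j j * χ y ^ 2 := by
  have h1 : ContDiff ℝ 1 (fderiv ℝ v) := hv.fderiv_right (by norm_num)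
  have h := integral_bilinear_hasLineDerivAt_right_eq_neg_left_of_integrable
    (μ := (volume : Measure (Fin 3 → ℝ))) (B := ContinuousLinearMap.mul ℝ ℝ) (v := fpE j)
    (f := fun z => fpFlux v z j) (f' := fun y => fpFluxDeriv v y j j)
    (g := fun y => χ y ^ 2) (g' := fun y => 2 * χ y * fpGradS χ y j)
    (by simpa using integrable_sq_mul_fpFluxDeriv hv hc hχ hχ0 j)
    (by simpa using integrable_fpFlux_mul_grad_sq hv hc hχ hχ0 j)
    (by simpa using integrable_fpFlux_mul_sq hv hc hχ hχ0 j)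
    (fun y hy => by
      have hy0 : y ≠ 0 := by
        rintro rfl
        exact hχ0 ((tsupport_mul_subset_left (f := χ) (g := χ)) (by simpa [sq] using hy))
      exact hasLineDerivAt_fpFlux hy0 (hv.differentiable (by simp) y) (h1.differentiable (by simp) y) j j)
    (fun y _ => hasLineDerivAt_sq hχ y j)
  simpa using h

/-- **`∫ χ²·div Φ = −∫ 2χ·⟪∇χ, Φ⟫`**: the smeared boundary flux. -/
theorem integral_sq_mul_fpDivFlux (hv : ContDiff ℝ 2 v) (hc : HasCompactSupport v) (hχ : ContDiff ℝ 2 χ)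
    (hχ0 : (0 : Fin 3 → ℝ) ∉ tsupport χ) :
    ∫ y, χ y ^ 2 * fpDivFlux y (v y) (fpGrad v y) = - ∫ y, 2 * χ y * fpFluxDotGrad v χ y := by
  -- pointwise: χ²·fpDivFlux = χ²·Σⱼ ∂ⱼΦⱼ (trace identity at y ≠ 0, χ = 0 off tsupport χ ∌ 0)
  have hpt : ∀ y, χ y ^ 2 * fpDivFlux y (v y) (fpGrad v y) =
      fpFluxDeriv v y 0 0 * χ y ^ 2 + fpFluxDeriv v y 1 1 * χ y ^ 2 + fpFluxDeriv v y 2 2 * χ y ^ 2 := by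
    intro y
    by_cases hy : y = 0
    · subst hy
      simp [image_eq_zero_of_notMem_tsupport hχ0]
    · rw [← sum_fpFluxDeriv_eq_fpDivFlux_of_contDiffAt v hy hv.contDiffAt]; ring
  have hpt' : ∀ y, 2 * χ y * fpFluxDotGrad v χ y =
      fpFlux v y 0 * (2 * χ y * fpGradS χ y 0) + fpFlux v y 1 * (2 * χ y * fpGradS χ y 1) +
        fpFlux v y 2 * (2 * χ y * fpGradS χ y 2) := by
    intro y; unfold fpFluxDotGrad; ring
  simp_rw [hpt, hpt']
  have i0 := integrable_sq_mul_fpFluxDeriv hv hc hχ hχ0 0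
  have i1 := integrable_sq_mul_fpFluxDeriv hv hc hχ hχ0 1
  have i2 := integrable_sq_mul_fpFluxDeriv hv hc hχ hχ0 2
  have k0 := integrable_fpFlux_mul_grad_sq hv hc hχ hχ0 0
  have k1 := integrable_fpFlux_mul_grad_sq hv hc hχ hχ0 1
  have k2 := integrable_fpFlux_mul_grad_sq hv hc hχ hχ0 2
  have e1 : ∫ y, (fpFluxDeriv v y 0 0 * χ y ^ 2 + fpFluxDeriv v y 1 1 * χ y ^ 2 + fpFluxDeriv v y 2 2 * χ y ^ 2) =
      (∫ y, (fpFluxDeriv v y 0 0 * χ y ^ 2 + fpFluxDeriv v y 1 1 * χ y ^ 2)) + ∫ y, fpFluxDeriv v y 2 2 * χ y ^ 2 :=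
    integral_add (i0.add i1) i2
  have e2 : ∫ y, (fpFluxDeriv v y 0 0 * χ y ^ 2 + fpFluxDeriv v y 1 1 * χ y ^ 2) =
      (∫ y, fpFluxDeriv v y 0 0 * χ y ^ 2) + ∫ y, fpFluxDeriv v y 1 1 * χ y ^ 2 := integral_add i0 i1
  have e3 : ∫ y, (fpFlux v y 0 * (2 * χ y * fpGradS χ y 0) + fpFlux v y 1 * (2 * χ y * fpGradS χ y 1) +
      fpFlux v y 2 * (2 * χ y * fpGradS χ y 2)) =
      (∫ y, (fpFlux v y 0 * (2 * χ y * fpGradS χ y 0) + fpFlux v y 1 * (2 * χ y * fpGradS χ y 1))) +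
        ∫ y, fpFlux v y 2 * (2 * χ y * fpGradS χ y 2) := integral_add (k0.add k1) k2
  have e4 : ∫ y, (fpFlux v y 0 * (2 * χ y * fpGradS χ y 0) + fpFlux v y 1 * (2 * χ y * fpGradS χ y 1)) =
      (∫ y, fpFlux v y 0 * (2 * χ y * fpGradS χ y 0)) + ∫ y, fpFlux v y 1 * (2 * χ y * fpGradS χ y 1) :=
    integral_add k0 k1
  rw [e1, e2, e3, e4, integral_sq_mul_fpFluxDeriv hv hc hχ hχ0 0, integral_sq_mul_fpFluxDeriv hv hc hχ hχ0 1,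
    integral_sq_mul_fpFluxDeriv hv hc hχ hχ0 2]
  ring

/-- **THE CONTINUUM FAR PENCIL WITH A SMEARED FREE BOUNDARY.**  For every `C²` vector field `v` with compact support (no condition at the
reference site), every `C²` weight `χ` with `0 ∉ tsupport χ`:
`∫ χ²·Num(x, v, ∇v) ≤ (17/200)·∫ χ²·Den(x, ∇v) + (1/18)·∫ 2χ⟪∇χ, Φ⟫`,
`Φ = fpFlux v` the explicit flux of `…FarPencilPointwise/Flux`.  The interface term is exact (no Young waste) and lives where `∇χ ≠ 0`.
NOT a proof of H12⋆, NOT summit progress. -/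
theorem farPencil_weighted_integral_le (hv : ContDiff ℝ 2 v) (hc : HasCompactSupport v) (hχ : ContDiff ℝ 2 χ)
    (hχ0 : (0 : Fin 3 → ℝ) ∉ tsupport χ) :
    ∫ x, χ x ^ 2 * fpNum x (v x) (fpGrad v x) ≤
      17 / 200 * (∫ x, χ x ^ 2 * fpDen x (fpGrad v x)) + 1 / 18 * ∫ x, 2 * χ x * fpFluxDotGrad v χ x := by
  have iN := integrable_sq_mul_fpNum hv hc hχ hχ0
  have iD := integrable_cut_receipts hv hc hχ hχ0
  have iΦ := integrable_sq_mul_fpDivFlux hv hc hχ hχ0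
  have hpt : ∀ x, χ x ^ 2 * fpNum x (v x) (fpGrad v x) + 1 / 18 * (χ x ^ 2 * fpDivFlux x (v x) (fpGrad v x)) ≤
      17 / 200 * (χ x ^ 2 * fpDen x (fpGrad v x)) := by
    intro x
    have h := mul_le_mul_of_nonneg_left (farPencil_pointwise_le' x (v x) (fpGrad v x)) (sq_nonneg (χ x))
    nlinarith [h]
  have h1 : (∫ x, χ x ^ 2 * fpNum x (v x) (fpGrad v x)) + 1 / 18 * ∫ x, χ x ^ 2 * fpDivFlux x (v x) (fpGrad v x) ≤
      17 / 200 * ∫ x, χ x ^ 2 * fpDen x (fpGrad v x) := by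
    rw [← integral_const_mul, ← integral_add iN (iΦ.const_mul _), ← integral_const_mul]
    exact integral_mono (iN.add (iΦ.const_mul _)) (iD.const_mul _) hpt
  rw [integral_sq_mul_fpDivFlux hv hc hχ hχ0] at h1
  linarith

end Summit.AtomisticToContinuum.Crystallization.Theorems.StrictSplittingRuleBirth
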